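import Summits.BirchSwinnertonDyer.Rank1Residual.WAll.AltClosersGlue
import Literature.NumberTheory.EllipticCurves.Rank1Residual.ClassX1KellerYinCertificate
import HarnessLib

/-!
# Rung W-ALL (D-0120): EXACTNESS of the leaf registry — every leaf used by `wAll_of_leaves` follows
# from W-ALL (cell `bsd-wall`, lane 2, seat ty-2)

HONEST FRAMING (cell `bsd-wall`, run/shared/lean/pub/bsd-wall/; WALL-BRIEF-v1 §2). NOTHING ASSERTED;
no `def`, no `@[conjecture]`, no named fact, no route file imported. `WAll/AltClosersGlue.lean` proves
`wAll_of_leaves : (registered rung leaves + typed targets + named residuals + print binders) → WAll`.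
This file proves the CONVERSE direction leaf by leaf — each registered leaf, typed target and named
residual hypothesis of that theorem is a CONSEQUENCE of `Summit.BirchSwinnertonDyer.WAll`, granted at
most Gross–Zagier–Kolyvagin (`hGZK`, for `Ш` finite, which the `MissingInputAt` currencies presuppose)
and modularity (`hmod`, for the print-shape currency `PPartBSD` of the K6 leaf) — so registering
these statements as closes-targets of W-ALL sub-rungs LOSES NOTHING and OVER-CLAIMS NOTHING: the leaf
set is exactly W-ALL modulo the tree's named published facts (`leaves_of_wAll` below, to be read with
`wAll_of_leaves`). Not covered (by design): the PRE binders of `AltClosersPre.lean` (statements about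
Selmer groups / `p`-adic `L`-functions, not consequences of BSD), rung W2 `N11.KimAtThreeRankZeroPUB`
(a structure theorem, not a BSD statement), and K7t `X12.CMAtTwo` (it quantifies over the Sylvester
cube-sum family without an analytic-rank hypothesis; its rank-one input is Hu–Shu–Yin 2019, outside
this file).

References: `WAll/Target.lean`, `WAll/Conjunction.lean` (`wAll_subclasses`, `wAllExclusions_of_wAll`),
`WAll/AltClosersGlue.lean`; `Typed/Basic.lean` (`missingPPartAt_of_bsdp`);
`Rank1Residual/ClassX1KellerYinCertificate.lean` (`pPart_of_bsdp`).
-/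

noncomputable section

open scoped Classical

open WeierstrassCurve Literature.NumberTheory.EllipticCurves
  Literature.NumberTheory.EllipticCurves.Rank1Residual
  Literature.NumberTheory.EllipticCurves.Rank1Residual.Typed
  Literature.NumberTheory.EllipticCurves.Wuthrich2014
  Literature.NumberTheory.EllipticCurves.ModularForms

set_option autoImplicit false

namespace Summit.BirchSwinnertonDyer.Rank1Residual.WAll

open Summit.BirchSwinnertonDyer
open Summit.BirchSwinnertonDyer.BirchSwinnertonDyer.Rank1Residual (NonCMAtTwo BSDpOnClassX9
  pPartBSD_iff_pPart)
open Summit.BirchSwinnertonDyer.BirchSwinnertonDyer.Theorems.Rank1ResidualX1Defs (BSDpOnClassX1)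

/-! ## §1 Leaves in the `BSDp` currency (no published fact needed) -/

/-- Leaf K4 from W-ALL. [folklore] -/
theorem nonCMAtTwo_of_wAll (h : WAll) : NonCMAtTwo := fun W _ _ _ hr ↦ h W 2 hr

/-- `X2.Target` (hence the K5 half) from W-ALL. [folklore] -/
theorem x2Target_of_wAll (h : WAll) : X2.Target := fun W _ _ p _ hr _ ↦ h W p hr

/-- `BSDpOnClassX1` (the other K5 half) from W-ALL. [folklore] -/
theorem bsdpOnClassX1_of_wAll (h : WAll) : BSDpOnClassX1 := fun W _ _ p _ _ hr ↦ h W p hr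

/-- Leaf K5 from W-ALL. [folklore] -/
theorem eisensteinPrimes_of_wAll (h : WAll) : Eisenstein.EisensteinPrimes :=
  ⟨bsdpOnClassX1_of_wAll h, x2Target_of_wAll h⟩

/-- Leaves K2a and K2b from W-ALL (`ClassX11b` carries `r = 1`). [folklore] -/
theorem rungK2_of_wAll (h : WAll) :
    X11b.MultiplicativeRankOne ∧ X11b.MultiplicativeRankOneAtThree :=
  ⟨fun W _ _ p _ hX _ ↦ h W p (by rw [hX.1]), fun W _ _ hX ↦ h W 3 (by rw [hX.1])⟩

/-- `X11a.Target` (and its parts `TargetThree`, `TargetLeaf`) from W-ALL. [folklore] -/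
theorem x11aTargets_of_wAll (h : WAll) : X11a.Target ∧ X11a.TargetThree ∧ X11a.TargetLeaf :=
  ⟨fun W _ _ p _ hr _ ↦ h W p hr, fun W _ _ p _ hc ↦ h W p (by rw [hc.1.1]; exact zero_le_one),
    fun W _ _ p _ hL ↦ h W p (by rw [hL.1.1]; exact zero_le_one)⟩

/-- `X10.BSDpOnClassX10b` from W-ALL (`ClassX10` forces `r ≤ 1`). [folklore] -/
theorem bsdpOnClassX10b_of_wAll (h : WAll) : X10.BSDpOnClassX10b :=
  fun W _ _ p _ hX _ ↦ h W p (ClassX10.analyticRank_le_one hX)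

/-- The additive targets `O5.Statement`, `O6.Statement` from W-ALL. [folklore] -/
theorem o5o6Statement_of_wAll (h : WAll) : Additive.O5.Statement ∧ Additive.O6.Statement :=
  ⟨fun W _ _ p _ hr _ ↦ h W p hr, fun W _ _ p _ hr _ ↦ h W p hr⟩

/-- Leaf K7r from W-ALL (class 𝒞₇ carries `r = 1`; every prime). [folklore] -/
theorem cmRamifiedSeven_of_wAll (h : WAll) : X12.CMRamifiedSeven := by
  intro W _ _ hC p hp
  haveI : Fact p.Prime := ⟨hp⟩
  exact h W p (by rw [hC.2.2.1])

/-! ## §2 Leaves in the `MissingInputAt` / lower-half currencies (GZK supplies `Ш` finite) -/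

/-- `MissingPPartAt` at every rank-`≤ 1` pair from W-ALL (GZK for finiteness). [folklore] -/
theorem missingPPartAt_of_wAll (hGZK : rank_eq_analyticRank_of_analyticRank_le_one) (h : WAll)
    (W : WeierstrassCurve ℚ) [W.IsElliptic] [W.IsGloballyMinimal] (p : ℕ) [Fact p.Prime]
    (hr : W.analyticRank ≤ 1) : MissingPPartAt W p := by
  haveI : Finite W.sha := (hGZK W hr).2
  exact missingPPartAt_of_bsdp W p (h W p hr)

/-- Leaf K3 from W-ALL + GZK (each `Xn.MissingInputAt` is two clauses, the lower half and the whole,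
both read off `MissingPPartAt`). [folklore] -/
theorem signedSupersingular_of_wAll (hGZK : rank_eq_analyticRank_of_analyticRank_le_one) (h : WAll) :
    Supersingular.SignedSupersingular := by
  intro W _ _ p _ hr _ _
  have hm := missingPPartAt_of_wAll hGZK h W p hr
  have hl := (lower_and_upper_of_missingPPartAt W p hm).1
  exact ⟨fun _ _ ↦ ⟨fun _ _ _ ↦ hl, fun _ ↦ hm⟩, fun _ ↦ ⟨fun _ _ _ ↦ hl, fun _ ↦ hm⟩,
    fun _ ↦ ⟨fun _ _ ↦ hl, fun _ ↦ hm⟩⟩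

/-- Leaf K8-CM `X12.CMInertBad` from W-ALL + GZK. [folklore] -/
theorem cmInertBad_of_wAll (hGZK : rank_eq_analyticRank_of_analyticRank_le_one) (h : WAll) :
    X12.CMInertBad :=
  fun W _ _ p _ _ hr1 _ _ _ _ ↦ missingPPartAt_of_wAll hGZK h W p (by rw [hr1])

/-- Leaves K8, K9-tame, K9-wild (`O5SharpGss`, `O5SharpTprime`, `O6Sharp`) from W-ALL + GZK. [folklore] -/
theorem sharpLeaves_of_wAll (hGZK : rank_eq_analyticRank_of_analyticRank_le_one) (h : WAll) :
    Additive.O5SharpGss ∧ Additive.O5SharpTprime ∧ Additive.O6Sharp :=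
  ⟨fun W _ _ p _ hr _ _ _ ↦ missingPPartAt_of_wAll hGZK h W p hr,
    fun W _ _ p _ hr _ _ _ ↦ missingPPartAt_of_wAll hGZK h W p hr,
    fun W _ _ p _ hr _ ↦ missingPPartAt_of_wAll hGZK h W p hr⟩

/-- Leaf K1 `AdditiveOrdinaryLowerHalf` and the named residual `hUp` (the upper half on
`N10.Locus`) from W-ALL + GZK. [folklore] -/
theorem additiveHalves_of_wAll (hGZK : rank_eq_analyticRank_of_analyticRank_le_one) (h : WAll) :
    Additive.AdditiveOrdinaryLowerHalf ∧
    (∀ (W : WeierstrassCurve ℚ) [W.IsElliptic] [W.IsGloballyMinimal] (p : ℕ) [Fact p.Prime],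
      W.analyticRank ≤ 1 → Additive.N10.Locus W p → MissingUpperBoundAt W p) :=
  ⟨fun W _ _ p _ hr _ ↦ (lower_and_upper_of_missingPPartAt W p (missingPPartAt_of_wAll hGZK h W p hr)).1,
    fun W _ _ p _ hr _ ↦ (lower_and_upper_of_missingPPartAt W p (missingPPartAt_of_wAll hGZK h W p hr)).2⟩

/-! ## §3 The K6 leaf (print-shape currency `PPartBSD`; modularity + GZK) -/

/-- Leaf K6 `BSDpOnClassX9` from W-ALL + modularity + GZK (`pPart_of_bsdp`, `pPartBSD_iff_pPart`).
[folklore] -/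
theorem bsdpOnClassX9_of_wAll (hmod : hasEntireLFunction_rat)
    (hGZK : rank_eq_analyticRank_of_analyticRank_le_one) (h : WAll) : BSDpOnClassX9 :=
  fun W _ _ p _ hr _ _ ↦ (pPartBSD_iff_pPart W p).mpr (pPart_of_bsdp hmod hGZK W p hr (h W p hr))

/-! ## §4 The registry is exact -/

/-- **EXACTNESS OF THE LEAF REGISTRY.** Granted modularity and Gross–Zagier–Kolyvagin, W-ALL implies
EVERY non-print hypothesis of `wAll_of_leaves` (leaves K4, K1 + hUp, K8, K9t, K9w, K2a, K2b, K5, K3,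
K6, the typed targets X10b / X11a, K8-CM and ty-1's two CM sub-corners) — read together with
`wAll_of_leaves`, the registered leaf set is EXACTLY rung W-ALL modulo the tree's named published
facts. [folklore] -/
theorem leaves_of_wAll (hmod : hasEntireLFunction_rat)
    (hGZK : rank_eq_analyticRank_of_analyticRank_le_one) (h : WAll) :
    NonCMAtTwo ∧ Additive.AdditiveOrdinaryLowerHalf ∧
    (∀ (W : WeierstrassCurve ℚ) [W.IsElliptic] [W.IsGloballyMinimal] (p : ℕ) [Fact p.Prime],
      W.analyticRank ≤ 1 → Additive.N10.Locus W p → MissingUpperBoundAt W p) ∧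
    Additive.O5SharpGss ∧ Additive.O5SharpTprime ∧ Additive.O6Sharp ∧
    X11b.MultiplicativeRankOne ∧ X11b.MultiplicativeRankOneAtThree ∧ Eisenstein.EisensteinPrimes ∧
    Supersingular.SignedSupersingular ∧ BSDpOnClassX9 ∧ X10.BSDpOnClassX10b ∧ X11a.Target ∧
    X12.CMInertBad ∧ WAllCornerFTwo ∧ WAllCornerFRamified := by
  obtain ⟨hK1, hUp⟩ := additiveHalves_of_wAll hGZK h
  obtain ⟨hK8, hK9t, hK9w⟩ := sharpLeaves_of_wAll hGZK h
  obtain ⟨hK2a, hK2b⟩ := rungK2_of_wAll h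
  obtain ⟨hF2, hFr, -⟩ := wAllCornerF_iff.mp (wAllExclusions_of_wAll h).2.2.2.2.2.2.2.2.2.2.2
  exact ⟨nonCMAtTwo_of_wAll h, hK1, hUp, hK8, hK9t, hK9w, hK2a, hK2b, eisensteinPrimes_of_wAll h,
    signedSupersingular_of_wAll hGZK h, bsdpOnClassX9_of_wAll hmod hGZK h, bsdpOnClassX10b_of_wAll h,
    (x11aTargets_of_wAll h).1, cmInertBad_of_wAll hGZK h, hF2, hFr⟩

end Summit.BirchSwinnertonDyer.Rank1Residual.WAll

end
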